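import Summits.AtomisticToContinuum.HydrodynamicLimit.Theorems.RelayRaceLocalityNearConstantShortTimeHLOrbitIntegrability
import Summits.AtomisticToContinuum.HydrodynamicLimit.Theorems.RelayRaceLocalityNearConstantShortTimeHLEntropyFluxRemainderA
import HarnessLib

/-!
# Crux `NearConstantShortTimeHL` (stmt-AtomisticToContinuum-12502), line `small-tilt-domination`:
# integrability in time along hard-sphere orbits (part B)

Support file for the crux `…Theses.RelayRaceLocality.NearConstantShortTimeHL`, line `small-tilt-domination`
(lead c3, wave 2), registered stub **`intervalIntegrable_integral_ballRate_orbit`**: along a good orbit of a hard-sphere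
flow, under the ball-packing cap `ρ̃σ³ ≤ η₁ < η₀` on `[a, b] ⊆ [0, t]`, the space integral of the entropy-rate density at
the ball averages, `r ↦ ∫ Θ_r(x)(ρ̃, m̃, ẽ)(Φ_r z) dx`, is interval integrable on `[a, b]`.

Proof. (i) BOUND: the coefficient fields `∂ₜλ, ∂ₖλ` of the three log-profile rows are bounded on `[a, b] × 𝕋³`
(rows jointly smooth on `[0, T') × 𝕋³` for a horizon `t < T' ≤ T`, `exists_horizon_of_packing_lt`,
`isSmoothSpaceTimeOn_logProfileRows`, `wf_row_package`); the compressibility factor `Z = 1 + η f_ex′(η)` is bounded on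
`[0, η₁]` (`f_ex = F` analytic on the open band, `wf_exists_compressibility_bound`); and the algebraic estimate
`wf_abs_rate_le` — `|Θ(W)| ≤ Λ(ρ' + 6‖m'‖ + (19 + 6Z)E' + (3/2)(1 + Z)c)` from Cauchy–Schwarz `‖m'‖² ≤ 2ρ'E'` and the
Young bound `E'‖m'‖ ≤ ρ'c/2` (`norm_ballMomentum_sq_le`, `ballEnergy_mul_norm_ballMomentum_le`) — together with the
kernel-height/speed bounds `wf_ballFields_le` give `|Θ_r(x)(W̃(Φ_r z))| ≤ C` on `[a, b] × 𝕋³`, hence `|∫ₓ| ≤ C`.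
(ii) MEASURABILITY: with the coefficient time CLAMPED to `[a, b]` the integrand is jointly Borel on `ℝ × 𝕋³`
(`wf_row_package`, `wg_measurable_ball*`, `wf_measurable_entropyRate`), so its `x`-integral is measurable in `r`
(`StronglyMeasurable.integral_prod_right'`) and agrees with the true one on `[a, b]`.

No definitions, no named facts. References: H.-T. Yau, Lett. Math. Phys. 22 (1991) §2; D. Ruelle, Statistical Mechanics
(1969) §3.4 (equation of state).
-/

noncomputable section

namespace Summit.AtomisticToContinuum.HydrodynamicLimit.Theorems.NearConstantShortTimeHL

open scoped BigOperators ENNReal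
open MeasureTheory Set Filter
open Literature.MathematicalPhysics.KineticTheory Literature.Analysis.FluidPDE Literature.Analysis.FunctionSpaces

/-! ### The compressibility factor and the pressure under the packing cap -/

/-- **The compressibility factor is bounded on `[0, η₁]`, `η₁ < η₀`**: `|1 + η f_ex′(η)| ≤ Z` there, because `f_ex`
agrees with the analytic `F` on the open band `(0, η₀)` (so `f_ex′ = F′` there, `Filter.EventuallyEq.deriv_eq`), `F′` is
continuous on the compact `[0, η₁]`, and the factor is `1` at `η = 0`. [cite: Ruelle1969, §3.4] -/
theorem wf_exists_compressibility_bound {η₀ η₁ : ℝ} {F : ℝ → ℝ}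
    (hFa : AnalyticOnNhd ℝ F (Set.Ioo (-η₀) η₀)) (hEq : Set.EqOn hsExcessFreeEnergy F (Set.Ico 0 η₀))
    (hη₁ : 0 < η₁) (hη₁₀ : η₁ < η₀) :
    ∃ Z, 0 ≤ Z ∧ ∀ η ∈ Set.Icc 0 η₁, |hsCompressibility η| ≤ Z := by
  have hsub : Icc 0 η₁ ⊆ Ioo (-η₀) η₀ := fun η hη => ⟨by linarith [hη.1], hη.2.trans_lt hη₁₀⟩
  obtain ⟨D, hD⟩ := isCompact_Icc.exists_bound_of_continuousOn (hFa.deriv.continuousOn.mono hsub)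
  have hD0 : 0 ≤ D := (norm_nonneg _).trans (hD 0 ⟨le_rfl, hη₁.le⟩)
  refine ⟨1 + η₁ * D, by positivity, fun η hη => ?_⟩
  unfold hsCompressibility
  rcases hη.1.eq_or_lt with h0 | hpos
  · rw [← h0, zero_mul, add_zero, abs_one]
    nlinarith
  · have hderiv : deriv hsExcessFreeEnergy η = deriv F η := by
      refine Filter.EventuallyEq.deriv_eq ?_
      filter_upwards [Ioo_mem_nhds hpos (hη.2.trans_lt hη₁₀)] with y hy
      exact hEq ⟨hy.1.le, hy.2⟩
    rw [hderiv]
    have hDη := hD η hη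
    rw [Real.norm_eq_abs] at hDη
    calc |1 + η * deriv F η| ≤ |(1 : ℝ)| + |η * deriv F η| := abs_add_le _ _
      _ = 1 + η * |deriv F η| := by rw [abs_one, abs_mul, abs_of_pos hpos]
      _ ≤ 1 + η₁ * D := by
          have := mul_le_mul hη.2 hDη (abs_nonneg _) hη₁.le
          linarith

/-- **The pressure at the state temperature is dominated by the energy**: for `ρ' ≥ 0`, `E' ≥ 0`,
`‖m'‖² ≤ 2ρ'E'` and `|Z(ρ'σ³)| ≤ Z`, `|p(ρ', θ(ρ', E', m'))| ≤ (2/3) Z E'`, since `ρ'θ = (2/3)(E' − ‖m'‖²/(2ρ')) ∈ [0, (2/3)E']`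
(`0` for `ρ' = 0` by `x/0 = 0`). [folklore] -/
theorem wf_abs_pressure_le {σ ρ' E' Z : ℝ} {m' : V3} (hρ' : 0 ≤ ρ') (hE' : 0 ≤ E')
    (hCS : ‖m'‖ ^ 2 ≤ 2 * ρ' * E') (hZc : |hsCompressibility (ρ' * σ ^ 3)| ≤ Z) :
    |hsPressure σ ρ' (stateTemp ρ' E' m')| ≤ 2 / 3 * Z * E' := by
  have hρθ : |ρ' * stateTemp ρ' E' m'| ≤ 2 / 3 * E' := by
    unfold stateTemp
    rcases hρ'.eq_or_lt with h0 | hpos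
    · rw [← h0, zero_mul, abs_zero]
      positivity
    · have hq : ‖m'‖ ^ 2 / (2 * ρ') ≤ E' := by
        rw [div_le_iff₀ (by positivity)]
        linarith [hCS]
      have hq0 : 0 ≤ ‖m'‖ ^ 2 / (2 * ρ') := by positivity
      have heq : ρ' * (2 / 3 * (E' / ρ' - ‖m'‖ ^ 2 / (2 * ρ' ^ 2))) =
          2 / 3 * (E' - ‖m'‖ ^ 2 / (2 * ρ')) := by
        field_simp
      rw [heq, abs_of_nonneg (by linarith)]
      linarith
  unfold hsPressure
  rw [abs_mul]
  calc |ρ' * stateTemp ρ' E' m'| * |hsCompressibility (ρ' * σ ^ 3)| ≤ 2 / 3 * E' * Z :=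
        mul_le_mul hρθ hZc (abs_nonneg _) (by positivity)
    _ = 2 / 3 * Z * E' := by ring

/-! ### The algebraic estimate of the entropy-rate density -/

/-- **Algebraic bound of the entropy-rate density at a kinetic state.** If all coefficients are bounded by `Λ`, the
state `(ρ', m', E')` satisfies `ρ', E' ≥ 0`, Cauchy–Schwarz `‖m'‖² ≤ 2ρ'E'` and the Young bound `E'‖m'‖ ≤ ρ'c/2` with
`c ≥ 0`, and the pressure obeys `|P| ≤ (2/3)ZE'`, then
`|A₀ρ' + Σⱼ A₁ⱼm'ⱼ + A₄E' + Σₖ B₀ₖm'ₖ + Σₖⱼ B₁ₖⱼ(m'ₖm'ⱼ/ρ' + δₖⱼP) + Σₖ B₄ₖ(E' + P)m'ₖ/ρ'|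
 ≤ Λ(ρ' + 6‖m'‖ + (19 + 6Z)E' + (3/2)(1 + Z)c)` (all divisions by `ρ' = 0` vanish). [folklore] -/
theorem wf_abs_rate_le {A0 A4 Λ ρ' E' c Z P : ℝ} {A1 B0 B4 : Fin 3 → ℝ} {B1 : Fin 3 → Fin 3 → ℝ} {m' : V3}
    (hΛ0 : |A0| ≤ Λ) (hΛ1 : ∀ j, |A1 j| ≤ Λ) (hΛ4 : |A4| ≤ Λ) (hB0 : ∀ k, |B0 k| ≤ Λ)
    (hB1 : ∀ k j, |B1 k j| ≤ Λ) (hB4 : ∀ k, |B4 k| ≤ Λ) (hρ' : 0 ≤ ρ') (hE' : 0 ≤ E') (hc : 0 ≤ c)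
    (hZ : 0 ≤ Z) (hCS : ‖m'‖ ^ 2 ≤ 2 * ρ' * E') (hY : E' * ‖m'‖ ≤ ρ' / 2 * c)
    (hP : |P| ≤ 2 / 3 * Z * E') :
    |A0 * ρ' + (∑ j, A1 j * m' j) + A4 * E' + (∑ k, B0 k * m' k) +
      (∑ k, ∑ j, B1 k j * (m' k * m' j / ρ' + if k = j then P else 0)) +
      ∑ k, B4 k * ((E' + P) * m' k / ρ')| ≤
      Λ * (ρ' + 6 * ‖m'‖ + (19 + 6 * Z) * E' + 3 / 2 * (1 + Z) * c) := by
  have hΛ : 0 ≤ Λ := (abs_nonneg _).trans hΛ0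
  have habs : ∀ j, |m' j| ≤ ‖m'‖ := fun j => by simpa using PiLp.norm_apply_le m' j
  have h3 : ∀ (f : Fin 3 → ℝ) (B : ℝ), (∀ j, f j ≤ B) → ∑ j, f j ≤ 3 * B := fun f B h =>
    (Finset.sum_le_sum fun j _ => h j).trans (by simp)
  have hprod : ∀ k j, |m' k * m' j / ρ'| ≤ 2 * E' := by
    intro k j
    rcases hρ'.eq_or_lt with h0 | hpos
    · rw [← h0, div_zero, abs_zero]
      positivity
    · rw [abs_div, abs_mul, abs_of_pos hpos, div_le_iff₀ hpos]
      calc |m' k| * |m' j| ≤ ‖m'‖ * ‖m'‖ := mul_le_mul (habs k) (habs j) (abs_nonneg _) (norm_nonneg _)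
        _ = ‖m'‖ ^ 2 := (sq _).symm
        _ ≤ 2 * E' * ρ' := by linarith [hCS]
  have hite : ∀ k j : Fin 3, |(if k = j then P else 0)| ≤ 2 / 3 * Z * E' := by
    intro k j
    split_ifs
    · exact hP
    · rw [abs_zero]
      positivity
  have hflux : ∀ k, |(E' + P) * m' k / ρ'| ≤ (1 + Z) * c / 2 := by
    intro k
    rcases hρ'.eq_or_lt with h0 | hpos
    · rw [← h0, div_zero, abs_zero]
      positivity
    · rw [abs_div, abs_mul, abs_of_pos hpos, div_le_iff₀ hpos]
      have hEP : |E' + P| ≤ (1 + Z) * E' := by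
        calc |E' + P| ≤ |E'| + |P| := abs_add_le _ _
          _ ≤ E' + 2 / 3 * Z * E' := by rw [abs_of_nonneg hE']; linarith
          _ ≤ (1 + Z) * E' := by nlinarith [mul_nonneg hZ hE']
      calc |E' + P| * |m' k| ≤ (1 + Z) * E' * ‖m'‖ := mul_le_mul hEP (habs k) (abs_nonneg _) (by positivity)
        _ = (1 + Z) * (E' * ‖m'‖) := by ring
        _ ≤ (1 + Z) * (ρ' / 2 * c) := mul_le_mul_of_nonneg_left hY (by positivity)
        _ = (1 + Z) * c / 2 * ρ' := by ring
  have hT1 : |A0 * ρ'| ≤ Λ * ρ' := by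
    rw [abs_mul, abs_of_nonneg hρ']
    exact mul_le_mul_of_nonneg_right hΛ0 hρ'
  have hT2 : |∑ j, A1 j * m' j| ≤ 3 * (Λ * ‖m'‖) :=
    (Finset.abs_sum_le_sum_abs _ _).trans (h3 _ _ fun j => by
      rw [abs_mul]; exact mul_le_mul (hΛ1 j) (habs j) (abs_nonneg _) hΛ)
  have hT3 : |A4 * E'| ≤ Λ * E' := by
    rw [abs_mul, abs_of_nonneg hE']
    exact mul_le_mul_of_nonneg_right hΛ4 hE'
  have hT4 : |∑ k, B0 k * m' k| ≤ 3 * (Λ * ‖m'‖) :=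
    (Finset.abs_sum_le_sum_abs _ _).trans (h3 _ _ fun k => by
      rw [abs_mul]; exact mul_le_mul (hB0 k) (habs k) (abs_nonneg _) hΛ)
  have hT5 : |∑ k, ∑ j, B1 k j * (m' k * m' j / ρ' + if k = j then P else 0)| ≤
      3 * (3 * (Λ * (2 * E' + 2 / 3 * Z * E'))) := by
    refine (Finset.abs_sum_le_sum_abs _ _).trans (h3 _ _ fun k => ?_)
    refine (Finset.abs_sum_le_sum_abs _ _).trans (h3 _ _ fun j => ?_)
    rw [abs_mul]
    exact mul_le_mul (hB1 k j) ((abs_add_le _ _).trans (add_le_add (hprod k j) (hite k j)))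
      (abs_nonneg _) hΛ
  have hT6 : |∑ k, B4 k * ((E' + P) * m' k / ρ')| ≤ 3 * (Λ * ((1 + Z) * c / 2)) :=
    (Finset.abs_sum_le_sum_abs _ _).trans (h3 _ _ fun k => by
      rw [abs_mul]; exact mul_le_mul (hB4 k) (hflux k) (abs_nonneg _) hΛ)
  obtain ⟨l1, u1⟩ := abs_le.1 hT1
  obtain ⟨l2, u2⟩ := abs_le.1 hT2
  obtain ⟨l3, u3⟩ := abs_le.1 hT3
  obtain ⟨l4, u4⟩ := abs_le.1 hT4
  obtain ⟨l5, u5⟩ := abs_le.1 hT5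
  obtain ⟨l6, u6⟩ := abs_le.1 hT6
  rw [abs_le]
  constructor <;> linarith

/-! ### Registered stub `intervalIntegrable_integral_ballRate_orbit` -/

/-- **Registered stub `intervalIntegrable_integral_ballRate_orbit`.** Along a good orbit of a hard-sphere flow, under the
ball-packing cap `ρ̃σ³ ≤ η₁ < η₀` on `[a, b] ⊆ [0, t]` (`t < T`, packing of the classical solution `< η₀` on `[0, t]`,
`f_ex = F` analytic on the band), `r ↦ ∫ Θ_r(x)(W̃(Φ_r z))(x) dx` is interval integrable on `[a, b]`: the integrand is
bounded on `[a, b] × 𝕋³` (bounded coefficients, bounded compressibility, kinetic inequalities, energy conservation) and,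
with the coefficient time clamped to `[a, b]`, jointly measurable, so the `x`-integral is a bounded measurable function
of `r ∈ [a, b]`. [cite: Yau1991, §2] -/
theorem intervalIntegrable_integral_ballRate_orbit : ∀ {η₀ : ℝ} {F : ℝ → ℝ}, 0 < η₀ → AnalyticOnNhd ℝ F (Set.Ioo (-η₀) η₀) → Set.EqOn hsExcessFreeEnergy F (Set.Ico 0 η₀) → ∀ {σ T : ℝ}, 0 < σ → ∀ {ρ θ : ℝ → T3 → ℝ} {u : ℝ → T3 → V3}, IsHardSphereEulerSolution σ T ρ u θ → ∀ {t : ℝ}, t ∈ Set.Ico 0 T → (∀ s ∈ Set.Icc 0 t, ∀ x, ρ s x * σ ^ 3 < η₀) → ∀ {η₁ : ℝ}, 0 < η₁ → η₁ < η₀ → ∀ {ε : ℝ} {n : ℕ} (Φ : HardSphereFlow (Torus.geometry (Fin 3)) ε n) {z : Config n (Fin 3) T3}, z ∈ Φ.good → ∀ {a b : ℝ}, 0 ≤ a → a ≤ b → b ≤ t → ∀ {ℓ : ℝ}, 0 < ℓ → ℓ < 1 / 2 → packCapOn Φ z (Set.Icc a b) ℓ σ η₁ → IntervalIntegrable (fun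 r => ∫ x, ballRate σ T ρ θ u r ℓ (Φ.flow r z) x) volume a b := by
  intro η₀ F hη₀ hFa hEq σ T hσ ρ θ u hE t ht hpack η₁ hη₁ hη₁₀ ε n Φ z hz a b ha hab hbt ℓ hℓ _hℓ2 hcap
  -- a horizon `t < T' ≤ T` below which the packing stays in the band; the rows are smooth on `[0, T') × 𝕋³`
  obtain ⟨T', htT', hT'T, hband⟩ := exists_horizon_of_packing_lt hE hσ ht hpack
  obtain ⟨hr0, hr1, hr4⟩ := isSmoothSpaceTimeOn_logProfileRows hη₀ hFa hEq hσ hE hT'T hband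
  have hbT' : b < T' := lt_of_le_of_lt hbt htT'
  have hl0 : Torus.IsSmoothSpaceTimeOn (Set.Ico 0 T') (lam0Row σ ρ θ u) := hr0
  have hl1 : Torus.IsSmoothSpaceTimeOn (Set.Ico 0 T') (lamRow θ u) := hr1
  have hl4 : Torus.IsSmoothSpaceTimeOn (Set.Ico 0 T') (lam4Row θ) := hr4
  obtain ⟨⟨C0, hC0⟩, hc0, hp0⟩ := wf_row_package (T := T) hl0 hT'T ha hab hbT'
  obtain ⟨⟨C1, hC1⟩, hc1, hp1⟩ := wf_row_package (T := T) hl1 hT'T ha hab hbT'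
  obtain ⟨⟨C4, hC4⟩, hc4, hp4⟩ := wf_row_package (T := T) hl4 hT'T ha hab hbT'
  -- bounds: compressibility on `[0, η₁]`, speeds along the orbit, kernel height
  obtain ⟨Z, hZ0, hZ⟩ := wf_exists_compressibility_bound hFa hEq hη₁ hη₁₀
  have hV0 : 0 ≤ Real.sqrt (2 * configEnergy z) := Real.sqrt_nonneg _
  have hΛC0 : C0 ≤ |C0| + |C1| + |C4| := by linarith [le_abs_self C0, abs_nonneg C1, abs_nonneg C4]
  have hΛC1 : C1 ≤ |C0| + |C1| + |C4| := by linarith [le_abs_self C1, abs_nonneg C0, abs_nonneg C4]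
  have hΛC4 : C4 ≤ |C0| + |C1| + |C4| := by linarith [le_abs_self C4, abs_nonneg C0, abs_nonneg C1]
  have hΛ0 : 0 ≤ |C0| + |C1| + |C4| := by positivity
  have habsv : ∀ (v : V3) (j : Fin 3), |v j| ≤ ‖v‖ := fun v j => by simpa using PiLp.norm_apply_le v j
  set V := Real.sqrt (2 * configEnergy z) with hVdef
  set K := (4 / 3 * Real.pi * ℓ ^ 3)⁻¹ with hKdef
  set Λ := |C0| + |C1| + |C4| with hΛdef
  -- (i) the pointwise bound on `[a, b] × 𝕋³`
  have hbound : ∀ r ∈ Set.Icc a b, ∀ x, |ballRate σ T ρ θ u r ℓ (Φ.flow r z) x| ≤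
      Λ * (K + 6 * (K * V) + (19 + 6 * Z) * (K * V ^ 2 / 2) + 3 / 2 * (1 + Z) * (K * V ^ 3)) := by
    intro r hr x
    obtain ⟨hρK, hmK, heK, hcK⟩ := wf_ballFields_le hℓ x (Φ.flow r z) hV0 (fun i => wf_norm_vel_le Φ hz r i)
    have hρ0 := ballDensity_nonneg ℓ x (Φ.flow r z)
    have he0 := ballEnergy_nonneg ℓ x (Φ.flow r z)
    have hc0' : 0 ≤ (n : ℝ)⁻¹ * ∑ i, ballKernel ℓ x ((Φ.flow r z) i).1 * ‖((Φ.flow r z) i).2‖ ^ 3 :=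
      mul_nonneg (inv_nonneg.2 (Nat.cast_nonneg n))
        (Finset.sum_nonneg fun i _ => mul_nonneg (ballKernel_nonneg ℓ x _) (by positivity))
    have hZc : |hsCompressibility (empiricalDensityField (Φ.flow r z) (ballKernel ℓ x) * σ ^ 3)| ≤ Z :=
      hZ _ ⟨by positivity, hcap r hr x⟩
    have hP := wf_abs_pressure_le hρ0 he0 (norm_ballMomentum_sq_le ℓ x (Φ.flow r z)) hZc
    obtain ⟨hA0, hB0⟩ := hC0 r hr x
    obtain ⟨hA1, hB1⟩ := hC1 r hr x
    obtain ⟨hA4, hB4⟩ := hC4 r hr x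
    have h1 : |ballRate σ T ρ θ u r ℓ (Φ.flow r z) x| ≤
        Λ * (empiricalDensityField (Φ.flow r z) (ballKernel ℓ x) +
          6 * ‖empiricalMomentumField (Φ.flow r z) (ballKernel ℓ x)‖ +
          (19 + 6 * Z) * empiricalEnergyField (Φ.flow r z) (ballKernel ℓ x) +
          3 / 2 * (1 + Z) * ((n : ℝ)⁻¹ * ∑ i, ballKernel ℓ x ((Φ.flow r z) i).1 * ‖((Φ.flow r z) i).2‖ ^ 3)) := by
      unfold ballRate entropyRate
      refine wf_abs_rate_le ?_ (fun j => ?_) ?_ (fun k => ?_) (fun k j => ?_) (fun k => ?_) hρ0 he0 hc0' hZ0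
        (norm_ballMomentum_sq_le ℓ x (Φ.flow r z)) (ballEnergy_mul_norm_ballMomentum_le ℓ x (Φ.flow r z)) hP
      · rw [← Real.norm_eq_abs]; exact hA0.trans hΛC0
      · exact (habsv _ j).trans (hA1.trans hΛC1)
      · rw [← Real.norm_eq_abs]; exact hA4.trans hΛC4
      · rw [← Real.norm_eq_abs]; exact (hB0 k).trans hΛC0
      · exact (habsv _ j).trans ((hB1 k).trans hΛC1)
      · rw [← Real.norm_eq_abs]; exact (hB4 k).trans hΛC4
    refine h1.trans (mul_le_mul_of_nonneg_left ?_ hΛ0)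
    have h19 : 0 ≤ 19 + 6 * Z := by positivity
    have h32 : 0 ≤ 3 / 2 * (1 + Z) := by positivity
    nlinarith [mul_le_mul_of_nonneg_left heK h19, mul_le_mul_of_nonneg_left hcK h32]
  -- (ii) joint measurability of the integrand with the coefficient time clamped to `[a, b]`
  have hmeas : Measurable fun p : ℝ × T3 =>
      ballRate σ T ρ θ u (max a (min b p.1)) ℓ (Φ.flow p.1 z) p.2 := by
    have hW : Measurable fun p : ℝ × T3 => Φ.flow p.1 z := (wf_measurable_flow Φ hz).comp measurable_fst
    unfold ballRate
    exact wf_measurable_entropyRate (τ := fun p : ℝ × T3 => max a (min b p.1)) (ξ := Prod.snd)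
      hc0.measurable hc1.measurable hc4.measurable (fun k => (hp0 k).measurable)
      (fun k => (hp1 k).measurable) (fun k => (hp4 k).measurable) (wg_measurable_ballDensity hW measurable_snd ℓ)
      (wg_measurable_ballEnergy hW measurable_snd ℓ) (wg_measurable_ballMomentum hW measurable_snd ℓ)
  have hSM : StronglyMeasurable fun r => ∫ x, ballRate σ T ρ θ u (max a (min b r)) ℓ (Φ.flow r z) x :=
    hmeas.stronglyMeasurable.integral_prod_right'
  have hclampId : ∀ r ∈ Set.Icc a b, max a (min b r) = r := fun r hr => by
    rw [min_eq_right hr.2, max_eq_right hr.1]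
  -- conclusion: a bounded a.e.-strongly measurable function on a finite interval is interval integrable
  refine (intervalIntegrable_const (c := Λ * (K + 6 * (K * V) + (19 + 6 * Z) * (K * V ^ 2 / 2) +
    3 / 2 * (1 + Z) * (K * V ^ 3)))).mono_fun' ?_ ?_
  · rw [uIoc_of_le hab]
    refine hSM.aestronglyMeasurable.congr ?_
    filter_upwards [ae_restrict_mem measurableSet_Ioc] with r hr
    rw [hclampId r (Ioc_subset_Icc_self hr)]
  · rw [uIoc_of_le hab]
    filter_upwards [ae_restrict_mem measurableSet_Ioc] with r hr
    calc ‖∫ x, ballRate σ T ρ θ u r ℓ (Φ.flow r z) x‖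
        ≤ Λ * (K + 6 * (K * V) + (19 + 6 * Z) * (K * V ^ 2 / 2) + 3 / 2 * (1 + Z) * (K * V ^ 3)) *
            (volume : Measure T3).real univ :=
          norm_integral_le_of_norm_le_const (ae_of_all _ fun x => by
            rw [Real.norm_eq_abs]; exact hbound r (Ioc_subset_Icc_self hr) x)
      _ = _ := by rw [probReal_univ, mul_one]

end Summit.AtomisticToContinuum.HydrodynamicLimit.Theorems.NearConstantShortTimeHL

end
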